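import Mathlib
import HarnessLib

/-!
# The action difference of a local change is carried by the touched terms only (masked evaluation is exact)

HONEST FRAMING: exact (Metropolis-corrected) sampling algorithms for lattice gauge theory;
figures of merit are autocorrelation/cost numbers at stated couplings and volumes; no
continuum-physics claim.

Venture `LatticeQCDFlow` (cell pub-lqcd), topic `Exactness`; FANOUT row 9 (`eng-latcore`, the
`latflow.core` engine).  NEW WORK of the cell (an elementary finite-sum identity), not a published
result; nothing is cited as a fact.

## Content

`latflow.core` 0.2.3 evaluates action DIFFERENCES of local changes from a plaquette MASK:
`GaugeField.action_partial(beta, mask)` and `ptbc.defect_sum(f, mask)` sum `Re tr U_p` (times the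
plaquette weight) over the listed plaquettes only (C `lc_plaquette_list`, cost ∝ mask size instead
of `6V`), and the PTBC swap / defect-protocol Metropolis ratios of the client rows are formed from
such masked sums (row 27's F2 cure (a)).  The release note records that the masked numbers are
bit-identical to the corresponding entries of the full plaquette field; THIS file is the reason the
masked DIFFERENCE is the exact action difference — for any action that is a sum of local terms:

* a family of terms `s p : (ι → G) → ℝ` indexed by a finite type `P` ("plaquettes"), each reading
  the configuration `x : ι → G` ("links") only through its stencil `st p : Finset ι`;
* `term_eq_of_agree_off` — a term whose stencil misses the changed link set `L` is unchanged;
* `action_sub_eq_sum_mask` — if `x` and `y` agree outside `L` and the mask `M` contains every term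
  whose stencil meets `L`, then `∑ p, s p y − ∑ p, s p x = ∑ p ∈ M, (s p y − s p x)`; in particular
  (`action_sub_eq_sum_touched`) with `M` = exactly the touched terms;
* `boltzmannRatio_eq_exp_mask` — hence the Boltzmann ratio `e^{−β S(y)} / e^{−β S(x)}` equals
  `e^{−β · (masked difference)}`: a Metropolis test or a replica-swap ratio computed from the mask is
  the exact one.  Plaquette weights (PTBC's defect factors `c_p`) are part of `s p`, so weighted
  actions are covered; so is any improved action once `st p` lists the links of the larger loop.

The hypothesis on `M` is the whole content: a mask that omits a plaquette containing a changed link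
gives a wrong ratio, silently.  In the engine the mask of a defect-ball / PTBC step is built from
the geometry (all plaquettes with a link in the updated region), which is exactly `hM`.
-/

namespace Summit.Ventures.LatticeQCDFlow.Exactness

open Finset

variable {P ι G : Type*} [Fintype P]

section LocalActionDifference

omit [Fintype P] in
/-- A term that reads only its stencil does not change when the configuration changes only on links
outside the stencil: if `x` and `y` agree off `L` and `st p` is disjoint from `L`, then
`s p x = s p y`. -/
theorem term_eq_of_agree_off {s : P → (ι → G) → ℝ} {st : P → Finset ι}
    (hs : ∀ p (x y : ι → G), (∀ l ∈ st p, x l = y l) → s p x = s p y)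
    {L : Finset ι} {x y : ι → G} (hxy : ∀ l ∉ L, x l = y l) {p : P}
    (hp : Disjoint (st p) L) : s p x = s p y :=
  hs p x y fun l hl => hxy l (Finset.disjoint_left.mp hp hl)

/-- MASKED EVALUATION OF AN ACTION DIFFERENCE IS EXACT.  Let the action be `∑ p, s p` with term
`p` reading only the links in `st p`.  If two configurations `x, y` agree outside a link set `L`
and the mask `M` contains every term whose stencil meets `L`, then the full action difference
equals the masked difference: `∑ p, s p y − ∑ p, s p x = ∑ p ∈ M, (s p y − s p x)`. -/
theorem action_sub_eq_sum_mask {s : P → (ι → G) → ℝ} {st : P → Finset ι}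
    (hs : ∀ p (x y : ι → G), (∀ l ∈ st p, x l = y l) → s p x = s p y)
    {L : Finset ι} {x y : ι → G} (hxy : ∀ l ∉ L, x l = y l)
    {M : Finset P} (hM : ∀ p, ¬ Disjoint (st p) L → p ∈ M) :
    (∑ p, s p y) - ∑ p, s p x = ∑ p ∈ M, (s p y - s p x) := by
  rw [← Finset.sum_sub_distrib]
  symm
  refine Finset.sum_subset (Finset.subset_univ M) fun p _ hpM => ?_
  have hdis : Disjoint (st p) L := by
    by_contra h
    exact hpM (hM p h)
  rw [term_eq_of_agree_off hs hxy hdis, sub_self]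

/-- The special case `M` = exactly the touched terms (those whose stencil meets `L`). -/
theorem action_sub_eq_sum_touched {s : P → (ι → G) → ℝ} {st : P → Finset ι}
    (hs : ∀ p (x y : ι → G), (∀ l ∈ st p, x l = y l) → s p x = s p y)
    {L : Finset ι} {x y : ι → G} (hxy : ∀ l ∉ L, x l = y l)
    [DecidablePred fun p => ¬ Disjoint (st p) L] :
    (∑ p, s p y) - ∑ p, s p x = ∑ p ∈ univ.filter (fun p => ¬ Disjoint (st p) L), (s p y - s p x) :=
  action_sub_eq_sum_mask hs hxy fun p hp => Finset.mem_filter.mpr ⟨Finset.mem_univ p, hp⟩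

/-- Consequently the BOLTZMANN RATIO of the two configurations is the exponential of the masked
difference: `exp (−β ∑ s·y) / exp (−β ∑ s·x) = exp (−β ∑_{p ∈ M} (s p y − s p x))` — a Metropolis
test or a replica-swap ratio computed from the mask alone is the exact one. -/
theorem boltzmannRatio_eq_exp_mask {s : P → (ι → G) → ℝ} {st : P → Finset ι}
    (hs : ∀ p (x y : ι → G), (∀ l ∈ st p, x l = y l) → s p x = s p y)
    {L : Finset ι} {x y : ι → G} (hxy : ∀ l ∉ L, x l = y l)
    {M : Finset P} (hM : ∀ p, ¬ Disjoint (st p) L → p ∈ M) (β : ℝ) :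
    Real.exp (-(β * ∑ p, s p y)) / Real.exp (-(β * ∑ p, s p x))
      = Real.exp (-(β * ∑ p ∈ M, (s p y - s p x))) := by
  rw [← Real.exp_sub, ← action_sub_eq_sum_mask hs hxy hM]
  congr 1
  ring

/-- WITHOUT the mask hypothesis the masked difference is wrong in general: two "plaquettes" on one
link (`P = Bool`, both terms reading link `()`, `s p x = x ()`), a change of that link from `0` to
`1`, and the mask `{true}` that forgets the plaquette `false`: the true difference is `2`, the
masked one is `1`. -/
theorem action_sub_ne_sum_badMask_example :
    let s : Bool → (Unit → ℝ) → ℝ := fun _ x => x ()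
    let x : Unit → ℝ := fun _ => 0
    let y : Unit → ℝ := fun _ => 1
    (∑ p, s p y) - ∑ p, s p x ≠ ∑ p ∈ ({true} : Finset Bool), (s p y - s p x) := by
  intro s x y
  simp [s, x, y]

end LocalActionDifference

end Summit.Ventures.LatticeQCDFlow.Exactness
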